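import Summits.ResolutionOfSingularities.ResolutionOfSingularities.Theses.ShadowGame

/-!
# Disproof of `ShadowGameWinR` (crux stmt-ResolutionOfSingularities-18182, route `ShadowGame`) — findings

Seeded by the refuter-first crux attack (refuter-rattack-stmt-ResolutionOfSingularities-18182-0, 2026-08-17).
The standing disprover (cdisprove) EXTENDS this file; read `BWinDim3.md` in this directory first.

## VERDICT (on paper, not yet kernel-checked): `ShadowGameWinR` is FALSE — B wins `SG^R_p(3)` for p = 2 and every p ≥ 5.

Witness (BWinDim3.md §§2–5).  n = 3, κ := perfect closure of `𝔽_p(t_{j,m} : j ∈ {2,3}, m ≥ 1)`,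
`φ_j := Σ_m t_{j,m} x^m`, Γ := the smooth formal curve `{u₂ = φ₂(x), u₃ = φ₃(x)}`,
`c₀ :=` coefficient function of `S₂·S₃·(S₂+S₃)`, `S_j := u_j − φ_j(x)` (three smooth formal surfaces through Γ).
B follows Γ: chart `x` (resp. the chart of the smaller x-order for `F = {2,3}`), translation = the next digits.
* INVARIANT 𝓕_Γ: in the completed local ring `R' = κ((x))⟦y₁,y₂⟧` of `κ⟦u⟧` along Γ the position is
  `e·S₁S₂S₃ + F^p`, `e` a unit, `S_i` with pairwise independent cotangent classes.
* CLOSURE: A's centres are coordinate strata; Γ lies in no coordinate plane at any stage (transcendence of the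
  digits, §5), so every centre meets Γ only in the closed point, the blow-up is an isomorphism at the generic point
  of Γ, `R'_Γ ≅ R'_{Γ'}`, exceptional equations and divided coordinates are UNITS of `R'`, cleaning adds p-th powers:
  𝓕 is preserved by every move of A (|F| = 1, 2, 3) under B's answer (§4).
* NO WHISTLE (LEMMA §3, p ≠ 3): a class in 𝓕_Γ is never `Terminal′`: a terminal class `W^A·V + G^p` has some `W_j`
  through Γ (Jacobian ideal ⊆ 𝔭_Γ), at most two, and they are parameters of `R'`; comparing initial forms of the
  `κ((x))`-differential, `e₀·d(s₁s₂s₃)` (order 2, `s₁s₂s₃` a square-free binary cubic) is never the initial form of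
  `d(ε·W₁^{A₁}W₂^{A₂})` (cases (1a)(1b)(2a)(2b)(2c); only p = 3, case (2a), leaks).
This is the route's KILL CRITERION (ii): a B-win at n ≤ 3 by a defect of the coordinate-stratum move alphabet
(A can never name the triple curve Γ) ⇒ close `refuted:ShadowGameWinR`, no third whistle.

## What a kernel proof needs (none of it is in the tree today)
(L1) `MvPowerSeries`: lowest homogeneous component of a product; from `Ideal.span (range w) = maximalIdeal` the
     linear parts of `w` are a basis (formal inverse function theorem light).
(L2) completion of `κ⟦u₁,u₂,u₃⟧` localised at the prime of a smooth formal curve, with coefficient field `κ((x))`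
     (Cohen), and the continuous `κ((x))`-derivations `∂/∂y_i`.
(L3) the transcendence lemma: a power series whose coefficients include infinitely many indeterminates over `L` is
     transcendental over `L((x))` (automorphism/conjugates argument, §5).
A cheaper kernel NEGATIVE LEMMA in reach (~1.5 kloc, only (L1) + finite algebra over `ZMod 2`): "every strategy whose
centres are always the point loses at (p,n) = (2,3)" from `c₀ = u₂u₃(u₂+u₃)` with τ = 0 (period 2: `x^k u₂u₃(u₂+u₃)`,
k alternating 0,1; non-terminality′ by cubic/quartic initial forms).  It is NOT a refutation (A may blow up the
x-axis there and win in two moves) — the genuine witness needs the non-coordinate Γ above.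

## n = 2 (positive by-product, §7 of the note): eventually-free and eventually-satellite plays of `SG^R_p(2)` terminate
for "always blow up the point" (toric potential in arc-adapted formal coordinates); mixed plays open.
-/

-- single-problem summit: the doubled namespace component `ResolutionOfSingularities` is forced
set_option linter.dupNamespace false

namespace Summit.ResolutionOfSingularities.ResolutionOfSingularities.Cruxes.ShadowGameWinR.Disproof

open Summit.ResolutionOfSingularities.ResolutionOfSingularities.Theses.ShadowGame

/-- TARGET of this work file (proved ON PAPER in `BWinDim3.md`; the `sorry` stands for (L1)–(L3) above):
B wins the repaired torsor shadow game in dimension 3 at p = 2 by following a generic non-coordinate formal curve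
through which three smooth formal surfaces of the start position pass; no strategy of A — shadow-measurable or
not — ever reaches a `Terminal′` position, because A's centres (coordinate strata) never contain that curve. -/
theorem shadowGameWinR_false : ¬ ShadowGameWinR := by
  sorry

end Summit.ResolutionOfSingularities.ResolutionOfSingularities.Cruxes.ShadowGameWinR.Disproof
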